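import Mathlib

/-!
# Crux `DivisionGap.ZeroOneTransfer` (stmt-ValiantsHypothesis-5066), line `charged-uncharged` —
stub `stub_rhombusKasteleyn` (THE RHOMBUS IS KASTELEYN), support file 1

Two self-contained ingredients of the registered stub `stub_rhombusKasteleyn`.

**Permutation algebra** (any finite type): for a fixed-point-free permutation `σ` all of whose
cycles are even, `sign σ · Π_v ε v (σ v) = 1` as soon as every cycle `c` contributes
`Π_{v ∈ supp c} ε v (σ v) = -1` (`sign_mul_prod_eq_one`); the cycle through `v₀` as the closed
simple walk `j ↦ σ^j v₀` (`pow_add_card_apply`, `pow_apply_injOn`, `prod_support_cycleOf`); and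
the ALTERNATING PAIRING of the points along the even cycles (`exists_pairing`).

**The orientation of the triangular lattice** drawn on `ℤ × ℤ` with the six unit steps
`±(1,0), ±(0,1), ±(1,-1)` (the step relation is written out verbatim as in the neighbouring stub
`stub_pickParity`): horizontal edges point right, vertical edges up in even columns and down in
odd columns, the antidiagonal `{(x, y+1), (x+1, y)}` towards its even-column end.  It is produced
by `exists_orientation` as a TABLE of six values (hypothesis shape `htab`) plus vanishing off the
steps; no `def` is declared.  Besides skew-symmetry and support, the one non-trivial fact is the
LOCAL IDENTITY `local_identity`: for EVERY closed lattice walk `W` of length `ℓ`,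
`Σ_{j<ℓ} (2 - E (W j) (W (j+1)) - (x_j y_{j+1} - x_{j+1} y_j)) ≡ 0 (mod 4)` (that is,
`2·#against + ℓ ≡ shoelace (mod 4)`), because the summand of a step `p → q` is `Φ q - Φ p (mod 4)`
for the potential `Φ (x, y) = x + T(x mod 4) · y`, `T = (1, 2, 3, 0)` — equivalently, every unit
triangle is clockwise-odd.  Everything is packaged in the registered sub-goal
`stub_rhombusKasteleyn_orientation` at the end. [folklore]
-/

set_option linter.dupNamespace false

namespace Summit.ValiantsHypothesis.ValiantsHypothesis.Theorems.DivisionGapZeroOneTransfer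

namespace RhombusKasteleyn

open Finset Equiv.Perm

section Perm

variable {V : Type*} [Fintype V] [DecidableEq V]

/-! #### Products over the cycles of a fixed-point-free permutation -/

/-- For a fixed-point-free permutation, a product over all points factors over the supports of
its cycles. [folklore] -/
theorem prod_univ_eq_prod_cycleFactors (σ : Equiv.Perm V) (hσ : ∀ v, σ v ≠ v) (f : V → ℤ) :
    ∏ v, f v = ∏ c ∈ σ.cycleFactorsFinset, ∏ v ∈ c.support, f v := by
  have hU : (univ : Finset V) = σ.cycleFactorsFinset.biUnion support := by
    ext v
    simp only [mem_univ, mem_biUnion, true_iff]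
    exact ⟨σ.cycleOf v, cycleOf_mem_cycleFactorsFinset_iff.mpr (mem_support.mpr (hσ v)),
      mem_support.mpr (by rw [cycleOf_apply_self]; exact hσ v)⟩
  have hdisj : (σ.cycleFactorsFinset : Set (Equiv.Perm V)).PairwiseDisjoint support :=
    fun c hc d hd hcd => (cycleFactorsFinset_pairwise_disjoint σ hc hd hcd).disjoint_support
  rw [hU, prod_biUnion hdisj]

/-- The sign of a permutation all of whose cycles are even is `(-1)^(number of cycles)`.
[folklore] -/
theorem sign_eq_of_even (σ : Equiv.Perm V)
    (heven : ∀ c ∈ σ.cycleFactorsFinset, Even #c.support) :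
    ((Equiv.Perm.sign σ : ℤˣ) : ℤ) = (-1) ^ #σ.cycleFactorsFinset := by
  rw [sign_of_cycleType]
  have hsum : Even σ.cycleType.sum := by
    rw [even_iff_two_dvd]
    refine Multiset.dvd_sum fun k hk => ?_
    rw [cycleType_def, Multiset.mem_map] at hk
    obtain ⟨c, hc, rfl⟩ := hk
    exact even_iff_two_dvd.mp (heven c hc)
  have hcard : Multiset.card σ.cycleType = #σ.cycleFactorsFinset := by
    rw [cycleType_def, Multiset.card_map]; rfl
  rw [Units.val_pow_eq_pow_val, Units.val_neg, Units.val_one, pow_add, hsum.neg_one_pow, one_mul,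
    hcard]

/-- **Reduction to cycles.** If every cycle of a fixed-point-free permutation `σ` is even and
contributes `Π_{v ∈ supp c} ε v (σ v) = -1`, then `sign σ · Π_v ε v (σ v) = 1`. [folklore] -/
theorem sign_mul_prod_eq_one (σ : Equiv.Perm V) (hσ : ∀ v, σ v ≠ v) (ε : V → V → ℤ)
    (heven : ∀ c ∈ σ.cycleFactorsFinset, Even #c.support)
    (hcyc : ∀ c ∈ σ.cycleFactorsFinset, ∏ v ∈ c.support, ε v (σ v) = -1) :
    ((Equiv.Perm.sign σ : ℤˣ) : ℤ) * ∏ v, ε v (σ v) = 1 := by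
  rw [prod_univ_eq_prod_cycleFactors σ hσ, prod_congr rfl hcyc, prod_const, sign_eq_of_even σ heven,
    ← pow_add, ← two_mul, pow_mul, neg_one_sq, one_pow]

/-! #### A cycle as a closed simple walk `j ↦ σ^j v₀` -/

/-- Periodicity: `σ^(j + ℓ) v₀ = σ^j v₀` for `ℓ` the length of the cycle through `v₀`. [folklore] -/
theorem pow_add_card_apply (σ : Equiv.Perm V) (v₀ : V) (j : ℕ) :
    (σ ^ (j + #(σ.cycleOf v₀).support)) v₀ = (σ ^ j) v₀ := by
  rw [← pow_mod_card_support_cycleOf_self_apply σ (j + _) v₀, Nat.add_mod_right,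
    pow_mod_card_support_cycleOf_self_apply]

/-- Simplicity: `j ↦ σ^j v₀` is injective on one period. [folklore] -/
theorem pow_apply_injOn (σ : Equiv.Perm V) {v₀ : V} (hv₀ : σ v₀ ≠ v₀) {i j : ℕ}
    (hi : i < #(σ.cycleOf v₀).support) (hj : j < #(σ.cycleOf v₀).support)
    (h : (σ ^ i) v₀ = (σ ^ j) v₀) : i = j :=
  (((isCycleOn_support_cycleOf σ v₀).pow_apply_eq_pow_apply
    ((mem_support_cycleOf_iff' hv₀).mpr (SameCycle.refl σ v₀))).mp h).eq_of_lt_of_lt hi hj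

/-- The support of the cycle through `v₀` is `{σ^j v₀ : j < ℓ}`. [folklore] -/
theorem support_cycleOf_eq_image (σ : Equiv.Perm V) {v₀ : V} (hv₀ : σ v₀ ≠ v₀) :
    (σ.cycleOf v₀).support = (range #(σ.cycleOf v₀).support).image fun j => (σ ^ j) v₀ := by
  ext y
  rw [mem_support_cycleOf_iff' hv₀, mem_image]
  constructor
  · intro h
    obtain ⟨i, hi, rfl⟩ := h.exists_pow_eq_of_mem_support (mem_support.mpr hv₀)
    exact ⟨i, mem_range.mpr hi, rfl⟩
  · rintro ⟨i, -, rfl⟩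
    exact sameCycle_pow_right.mpr (SameCycle.refl σ v₀)

/-- A product over the support of the cycle through `v₀`, reindexed by the walk `j ↦ σ^j v₀`.
[folklore] -/
theorem prod_support_cycleOf (σ : Equiv.Perm V) {v₀ : V} (hv₀ : σ v₀ ≠ v₀) (f : V → ℤ) :
    ∏ v ∈ (σ.cycleOf v₀).support, f v = ∏ j ∈ range #(σ.cycleOf v₀).support, f ((σ ^ j) v₀) := by
  conv_lhs => rw [support_cycleOf_eq_image σ hv₀]
  rw [prod_image]
  intro i hi j hj h
  exact pow_apply_injOn σ hv₀ (mem_range.mp hi) (mem_range.mp hj) h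

/-! #### Pairing the points along the even cycles -/

/-- **Alternating pairing.** If `σ` is fixed-point-free and all its cycles are even, there is an
involution `g` with `g x ∈ {σ x, σ⁻¹ x}` (so `g x ≠ x` and `g x` lies on the cycle of `x`):
alternate along each cycle starting from a base point. [folklore] -/
theorem exists_pairing (σ : Equiv.Perm V) (hσ : ∀ v, σ v ≠ v)
    (heven : ∀ c ∈ σ.cycleFactorsFinset, Even #c.support) :
    ∃ g : V → V, ∀ x, (g x = σ x ∨ σ (g x) = x) ∧ g (g x) = x ∧ σ.SameCycle x (g x) := by
  classical
  cases isEmpty_or_nonempty V with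
  | inl hV => exact ⟨fun x => x, fun x => isEmptyElim x⟩
  | inr hV =>
  -- a base point on each cycle
  let base : V → V := fun x => Classical.epsilon (σ.SameCycle x)
  have hbase : ∀ x, σ.SameCycle x (base x) := fun x =>
    Classical.epsilon_spec (p := σ.SameCycle x) ⟨x, SameCycle.refl σ x⟩
  have hbase_eq : ∀ x y, σ.SameCycle x y → base x = base y := fun x y h => by
    change Classical.epsilon (σ.SameCycle x) = Classical.epsilon (σ.SameCycle y)
    congr 1
    funext z
    exact propext ⟨fun hx => h.symm.trans hx, fun hy => h.trans hy⟩
  have hmem : ∀ x, x ∈ σ.support := fun x => mem_support.mpr (hσ x)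
  -- the position of `x` on its cycle, counted from the base point
  have hpos : ∀ x, ∃ i < #(σ.cycleOf (base x)).support, (σ ^ i) (base x) = x := fun x =>
    (hbase x).symm.exists_pow_eq_of_mem_support (hmem _)
  choose pos _hpos_lt hpos_eq using hpos
  have hℓ : ∀ x, Even #(σ.cycleOf x).support := fun x =>
    heven _ (cycleOf_mem_cycleFactorsFinset_iff.mpr (hmem x))
  -- the parity of the position flips along `σ`
  have hflip : ∀ x, Even (pos (σ x)) ↔ ¬ Even (pos x) := by
    intro x
    have hb : base (σ x) = base x :=
      (hbase_eq x (σ x) (sameCycle_apply_right.mpr (SameCycle.refl σ x))).symm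
    have h1 : (σ ^ pos (σ x)) (base x) = (σ ^ (pos x + 1)) (base x) := by
      rw [pow_succ', mul_apply, hpos_eq x, ← hb, hpos_eq (σ x)]
    have hmod : pos (σ x) ≡ pos x + 1 [MOD #(σ.cycleOf (base x)).support] :=
      ((isCycleOn_support_cycleOf σ (base x)).pow_apply_eq_pow_apply
        ((mem_support_cycleOf_iff' (hσ _)).mpr (SameCycle.refl _ _))).mp h1
    have h2 : pos (σ x) ≡ pos x + 1 [MOD 2] := hmod.of_dvd (even_iff_two_dvd.mp (hℓ (base x)))
    rw [Nat.even_iff, Nat.even_iff, h2]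
    omega
  refine ⟨fun x => if Even (pos x) then σ x else σ.symm x, fun x => ?_⟩
  dsimp only
  refine ⟨?_, ?_, ?_⟩
  · by_cases h : Even (pos x)
    · left; rw [if_pos h]
    · right; rw [if_neg h, Equiv.apply_symm_apply]
  · by_cases h : Even (pos x)
    · have h' : ¬ Even (pos (σ x)) := by rwa [hflip, not_not]
      rw [if_pos h, if_neg h', Equiv.symm_apply_apply]
    · have h' : Even (pos (σ.symm x)) := by
        have := hflip (σ.symm x)
        rw [Equiv.apply_symm_apply] at this
        tauto
      rw [if_neg h, if_pos h', Equiv.apply_symm_apply]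
  · by_cases h : Even (pos x)
    · rw [if_pos h]
      exact sameCycle_apply_right.mpr (SameCycle.refl σ x)
    · rw [if_neg h]
      exact sameCycle_symm_apply_right.mpr (SameCycle.refl σ x)

end Perm

/-! #### The orientation: table of values, support, skew-symmetry -/

/-- **The orientation exists**: a function `E` on `ℤ × ℤ` with the six tabulated values on the unit
steps (right `+1`, left `-1`, up/down `±1` by column parity, antidiagonal towards the even column)
and `0` off the steps. [folklore] -/
theorem exists_orientation :
    ∃ E : ℤ × ℤ → ℤ × ℤ → ℤ,
      (∀ p : ℤ × ℤ, E p (p + (1, 0)) = 1 ∧ E (p + (1, 0)) p = -1 ∧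
        E p (p + (0, 1)) = (if p.1 % 2 = 0 then 1 else -1) ∧
        E (p + (0, 1)) p = (if p.1 % 2 = 0 then -1 else 1) ∧
        E p (p + (1, -1)) = (if p.1 % 2 = 0 then -1 else 1) ∧
        E (p + (1, -1)) p = (if p.1 % 2 = 0 then 1 else -1)) ∧
      (∀ p q : ℤ × ℤ, ¬ (q = p + (1, 0) ∨ p = q + (1, 0) ∨ q = p + (0, 1) ∨ p = q + (0, 1) ∨
          q = p + (1, -1) ∨ p = q + (1, -1)) → E p q = 0) := by
  refine ⟨fun p q =>
    if q.1 = p.1 + 1 ∧ q.2 = p.2 then 1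
    else if p.1 = q.1 + 1 ∧ q.2 = p.2 then -1
    else if q.1 = p.1 ∧ q.2 = p.2 + 1 then (if p.1 % 2 = 0 then 1 else -1)
    else if q.1 = p.1 ∧ p.2 = q.2 + 1 then (if p.1 % 2 = 0 then -1 else 1)
    else if (q.1 = p.1 + 1 ∧ p.2 = q.2 + 1) ∨ (p.1 = q.1 + 1 ∧ q.2 = p.2 + 1) then
      (if p.1 % 2 = 0 then -1 else 1)
    else 0, fun p => ?_, fun p q h => ?_⟩
  · obtain ⟨x, y⟩ := p
    refine ⟨?_, ?_, ?_, ?_, ?_, ?_⟩ <;> norm_num [Prod.mk_add_mk] <;> (try split_ifs) <;> omega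
  · obtain ⟨x, y⟩ := p
    obtain ⟨a, b⟩ := q
    simp only [Prod.mk_add_mk, Prod.mk.injEq, not_or, not_and] at h
    dsimp only
    split_ifs <;> omega

variable (E : ℤ × ℤ → ℤ × ℤ → ℤ)
  (htab : ∀ p : ℤ × ℤ, E p (p + (1, 0)) = 1 ∧ E (p + (1, 0)) p = -1 ∧
    E p (p + (0, 1)) = (if p.1 % 2 = 0 then 1 else -1) ∧
    E (p + (0, 1)) p = (if p.1 % 2 = 0 then -1 else 1) ∧
    E p (p + (1, -1)) = (if p.1 % 2 = 0 then -1 else 1) ∧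
    E (p + (1, -1)) p = (if p.1 % 2 = 0 then 1 else -1))
include htab

/-- On a step the orientation is `±1`. [folklore] -/
theorem val_of_step {p q : ℤ × ℤ}
    (hR : q = p + (1, 0) ∨ p = q + (1, 0) ∨ q = p + (0, 1) ∨ p = q + (0, 1) ∨
      q = p + (1, -1) ∨ p = q + (1, -1)) : E p q = 1 ∨ E p q = -1 := by
  rcases hR with rfl | rfl | rfl | rfl | rfl | rfl
  · exact Or.inl (htab p).1
  · exact Or.inr (htab q).2.1
  · rw [(htab p).2.2.1]; split_ifs <;> simp
  · rw [(htab q).2.2.2.1]; split_ifs <;> simp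
  · rw [(htab p).2.2.2.2.1]; split_ifs <;> simp
  · rw [(htab q).2.2.2.2.2]; split_ifs <;> simp

omit htab in
/-- The step relation is symmetric. [folklore] -/
theorem step_symm {p q : ℤ × ℤ}
    (hR : q = p + (1, 0) ∨ p = q + (1, 0) ∨ q = p + (0, 1) ∨ p = q + (0, 1) ∨
      q = p + (1, -1) ∨ p = q + (1, -1)) :
    p = q + (1, 0) ∨ q = p + (1, 0) ∨ p = q + (0, 1) ∨ q = p + (0, 1) ∨
      p = q + (1, -1) ∨ q = p + (1, -1) := by
  rcases hR with h | h | h | h | h | h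
  · exact Or.inr (Or.inl h)
  · exact Or.inl h
  · exact Or.inr (Or.inr (Or.inr (Or.inl h)))
  · exact Or.inr (Or.inr (Or.inl h))
  · exact Or.inr (Or.inr (Or.inr (Or.inr (Or.inr h))))
  · exact Or.inr (Or.inr (Or.inr (Or.inr (Or.inl h))))

/-- Skew-symmetry `E p q = -E q p` and support `E p q ≠ 0 ↔ step`, given vanishing off the steps.
[folklore] -/
theorem skew_and_support
    (h0 : ∀ p q : ℤ × ℤ, ¬ (q = p + (1, 0) ∨ p = q + (1, 0) ∨ q = p + (0, 1) ∨ p = q + (0, 1) ∨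
      q = p + (1, -1) ∨ p = q + (1, -1)) → E p q = 0) (p q : ℤ × ℤ) :
    E p q = -E q p ∧ (E p q ≠ 0 ↔ (q = p + (1, 0) ∨ p = q + (1, 0) ∨ q = p + (0, 1) ∨
      p = q + (0, 1) ∨ q = p + (1, -1) ∨ p = q + (1, -1))) := by
  refine ⟨?_, fun h => by_contra fun hR => h (h0 p q hR),
    fun hR => by rcases val_of_step E htab hR with h | h <;> simp [h]⟩
  by_cases hR : q = p + (1, 0) ∨ p = q + (1, 0) ∨ q = p + (0, 1) ∨ p = q + (0, 1) ∨
      q = p + (1, -1) ∨ p = q + (1, -1)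
  · rcases hR with rfl | rfl | rfl | rfl | rfl | rfl
    · rw [(htab p).1, (htab p).2.1]; norm_num
    · rw [(htab q).2.1, (htab q).1]
    · rw [(htab p).2.2.1, (htab p).2.2.2.1]; split_ifs <;> norm_num
    · rw [(htab q).2.2.2.1, (htab q).2.2.1]; split_ifs <;> norm_num
    · rw [(htab p).2.2.2.2.1, (htab p).2.2.2.2.2]; split_ifs <;> norm_num
    · rw [(htab q).2.2.2.2.2, (htab q).2.2.2.2.1]; split_ifs <;> norm_num
  · rw [h0 p q hR, h0 q p fun h => hR (step_symm h)]; norm_num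

/-! #### The local identity `2·#against + ℓ ≡ shoelace (mod 4)` -/

/-- **One step.** For a step `p → q`, `2 - E p q - (x_p y_q - x_q y_p) ≡ Φ q - Φ p (mod 4)` for
the potential `Φ (x, y) = x + T(x mod 4) · y`, `T = (1, 2, 3, 0)` (a lift of
`x + y (1 - x + 2 [x odd])`); twelve cases (direction × column parity). [folklore] -/
theorem step_identity (Φ : ℤ × ℤ → ℤ)
    (hΦ : ∀ p : ℤ × ℤ, Φ p = p.1 + (if p.1 % 4 = 0 then p.2 else if p.1 % 4 = 1 then 2 * p.2
      else if p.1 % 4 = 2 then 3 * p.2 else 0))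
    {p q : ℤ × ℤ}
    (hR : q = p + (1, 0) ∨ p = q + (1, 0) ∨ q = p + (0, 1) ∨ p = q + (0, 1) ∨
      q = p + (1, -1) ∨ p = q + (1, -1)) :
    (4 : ℤ) ∣ (2 - E p q - (p.1 * q.2 - q.1 * p.2)) - (Φ q - Φ p) := by
  rcases hR with rfl | rfl | rfl | rfl | rfl | rfl
  · rw [(htab p).1, hΦ, hΦ]
    obtain ⟨x, y⟩ := p
    simp only [Prod.mk_add_mk, add_zero]
    rw [show x * y - (x + 1) * y = -y by ring]
    split_ifs <;> omega
  · rw [(htab q).2.1, hΦ, hΦ]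
    obtain ⟨x, y⟩ := q
    simp only [Prod.mk_add_mk, add_zero]
    rw [show (x + 1) * y - x * y = y by ring]
    split_ifs <;> omega
  · rw [(htab p).2.2.1, hΦ, hΦ]
    obtain ⟨x, y⟩ := p
    simp only [Prod.mk_add_mk, add_zero]
    rw [show x * (y + 1) - x * y = x by ring]
    split_ifs <;> omega
  · rw [(htab q).2.2.2.1, hΦ, hΦ]
    obtain ⟨x, y⟩ := q
    simp only [Prod.mk_add_mk, add_zero]
    rw [show x * y - x * (y + 1) = -x by ring]
    split_ifs <;> omega
  · rw [(htab p).2.2.2.2.1, hΦ, hΦ]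
    obtain ⟨x, y⟩ := p
    simp only [Prod.mk_add_mk]
    rw [show x * (y + -1) - (x + 1) * y = -x - y by ring]
    split_ifs <;> omega
  · rw [(htab q).2.2.2.2.2, hΦ, hΦ]
    obtain ⟨x, y⟩ := q
    simp only [Prod.mk_add_mk]
    rw [show (x + 1) * y - x * (y + -1) = x + y by ring]
    split_ifs <;> omega

/-- **The local identity.** For every closed lattice walk `W` of length `ℓ` (steps along the six
directions, `W ℓ = W 0`; no simplicity or topology needed),
`Σ_{j<ℓ} (2 - E (W j) (W (j+1)) - (x_j y_{j+1} - x_{j+1} y_j)) ≡ 0 (mod 4)`: the step summands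
telescope by `step_identity`. [folklore] -/
theorem local_identity (ℓ : ℕ) (W : ℕ → ℤ × ℤ)
    (hstep : ∀ j, W (j + 1) = W j + (1, 0) ∨ W j = W (j + 1) + (1, 0) ∨ W (j + 1) = W j + (0, 1) ∨
      W j = W (j + 1) + (0, 1) ∨ W (j + 1) = W j + (1, -1) ∨ W j = W (j + 1) + (1, -1))
    (hcl : W ℓ = W 0) :
    (4 : ℤ) ∣ ∑ j ∈ range ℓ,
      (2 - E (W j) (W (j + 1)) - ((W j).1 * (W (j + 1)).2 - (W (j + 1)).1 * (W j).2)) := by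
  obtain ⟨Φ, hΦ⟩ : ∃ Φ : ℤ × ℤ → ℤ, ∀ p : ℤ × ℤ, Φ p = p.1 + (if p.1 % 4 = 0 then p.2
      else if p.1 % 4 = 1 then 2 * p.2 else if p.1 % 4 = 2 then 3 * p.2 else 0) := ⟨_, fun p => rfl⟩
  have key : ∀ j, (4 : ℤ) ∣ (2 - E (W j) (W (j + 1)) -
      ((W j).1 * (W (j + 1)).2 - (W (j + 1)).1 * (W j).2)) - (Φ (W (j + 1)) - Φ (W j)) :=
    fun j => step_identity E htab Φ hΦ (hstep j)
  have hsum := dvd_sum fun j (_ : j ∈ range ℓ) => key j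
  have htel : ∑ j ∈ range ℓ, (Φ (W (j + 1)) - Φ (W j)) = Φ (W ℓ) - Φ (W 0) :=
    sum_range_sub (fun j => Φ (W j)) ℓ
  rwa [sum_sub_distrib, htel, hcl, sub_self, sub_zero] at hsum

end RhombusKasteleyn

open RhombusKasteleyn in
/-- **Registered sub-goal `stub_rhombusKasteleyn_orientation`** of `stub_rhombusKasteleyn` (crux
stmt-ValiantsHypothesis-5066, line `charged-uncharged`): THE KASTELEYN ORIENTATION OF THE
TRIANGULAR LATTICE, on `ℤ × ℤ` with steps `±(1,0), ±(0,1), ±(1,-1)` — a skew sign function `E`,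
nonzero exactly on the steps, `±1` there, such that for EVERY closed lattice walk `W` of length
`ℓ`, `Σ_{j<ℓ} (2 - E (W j) (W (j+1)) - (x_j y_{j+1} - x_{j+1} y_j)) ≡ 0 (mod 4)`
(`2·#against + ℓ ≡ shoelace (mod 4)`; every unit triangle is clockwise-odd).  Explicitly:
horizontal edges point right, vertical edges up in even columns / down in odd columns, the
antidiagonal towards its even-column end. [cite: Kasteleyn1961] -/
theorem stub_rhombusKasteleyn_orientation : ∃ E : ℤ × ℤ → ℤ × ℤ → ℤ, (∀ p q, E p q = -E q p) ∧ (∀ p q, E p q ≠ 0 ↔ (q = p + (1, 0) ∨ p = q + (1, 0) ∨ q = p + (0, 1) ∨ p = q + (0, 1) ∨ q = p + (1, -1) ∨ p = q + (1, -1))) ∧ (∀ p q, (q = p + (1, 0) ∨ p = q + (1, 0) ∨ q = p + (0, 1) ∨ p = q + (0, 1) ∨ q = p + (1, -1) ∨ p = q + (1, -1)) → E p q = 1 ∨ E p q = -1) ∧ ∀ (ℓ : ℕ) (W : ℕ → ℤ × ℤ), (∀ j, W (j + 1) = W j + (1, 0) ∨ W j = W (j + 1) + (1, 0) ∨ W (j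 + 1) = W j + (0, 1) ∨ W j = W (j + 1) + (0, 1) ∨ W (j + 1) = W j + (1, -1) ∨ W j = W (j + 1) + (1, -1)) → W ℓ = W 0 → (4 : ℤ) ∣ ∑ j ∈ Finset.range ℓ, (2 - E (W j) (W (j + 1)) - ((W j).1 * (W (j + 1)).2 - (W (j + 1)).1 * (W j).2)) := by
  obtain ⟨E, htab, h0⟩ := exists_orientation
  exact ⟨E, fun p q => (skew_and_support E htab h0 p q).1, fun p q => (skew_and_support E htab h0 p q).2,
    fun p q h => val_of_step E htab h, fun ℓ W hstep hcl => local_identity E htab ℓ W hstep hcl⟩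

end Summit.ValiantsHypothesis.ValiantsHypothesis.Theorems.DivisionGapZeroOneTransfer
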